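import Summits.BirchSwinnertonDyer.Rank1Residual.ManinAdditive.NineShiftEqualiserLaw
import Literature.NumberTheory.EllipticCurves.Gamma0CocycleDegeneracyMaps
import HarnessLib

/-!
# E-es-101 `TowerReduction` HOLDS — the 3-adic tower reduction of the nine-shift equaliser law is pure glue
# (route `ManinLocalTwoThree`, cell bsd-f2-manin; crux C3 `ManinPrimeToThreeAtNine` stmt-BirchSwinnertonDyer-22968;
# prover seat p3 gen 10, es ask P-es-1)

The cell's es seat (g23, MEMO-es §37.8) typed in `…/ManinAdditive/NineShiftEqualiserLaw.lean` the sharp law E-es-94♯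
`NineShiftInvariantIsDiamond` («for `9 ∣ N` every additive character `Γ₀(N) → 𝔽₃` invariant under conjugation by
`diag(9,1)` on `Γ₀(9N)` vanishes on `Γ₁(N)`» — the Eisenstein part of the `t = 9` degeneracy equaliser mod `3`, the
f-free statement upstream of C3's reducible residual) together with four structural rows — THEOREM III
`ThreeShiftTowerDescent` (E-es-98), THEOREM III′ `ThreeShiftAntiInvariantDescent` (E-es-99) and the two single-depth
bases `ThreeShiftBaseNine` (E-es-100a), `AntiInvariantBaseTwentySeven` (E-es-100b) — and the GLUE row E-es-101
`TowerReduction : ThreeShiftTowerDescent → ThreeShiftAntiInvariantDescent → ThreeShiftBaseNine →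
AntiInvariantBaseTwentySeven → NineShiftInvariantIsDiamond`, proved on paper (MEMO-es §37.8 (vi)).

THIS FILE proves `TowerReduction` in Lean (**`towerReduction_holds`**).  The chain, for `N = 3^k·N₀` (`k ≥ 2`, `3 ∤ N₀`)
and an additive nine-shift-invariant `φ : Γ₀(N) → 𝔽₃`:
1. the 3-SHIFT DEFECT `ψ(γ) := φ(γ) − φ(diag(3,1) γ diag(3,1)⁻¹)` on `Γ₀(3N)` (both maps are the tree's degeneracy
   conjugations `Gamma0.degeneracyConj N (3N) 1 / 3`, so `ψ` is additive) is ANTI-invariant under the 3-shift because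
   `φ` is invariant under the 9-shift (`isThreeShiftAntiInvariant_shiftDefect`);
2. `3N = 3^(k−2)·(27N₀)`: descend `ψ` by III′ down to level `27N₀` and kill it there by E-es-100b
   (`eq_zero_of_antiInvariant_tower`), so `ψ = 0`, i.e. `φ` is 3-shift invariant (`isThreeShiftInvariant_of_shiftDefect_eq_zero`);
3. `N = 3^(k−2)·(9N₀)`: descend `φ` by III down to level `9N₀`, where E-es-100a makes it a diamond class, and the
   restriction of a diamond class is a diamond class (`isDiamondChar_of_tower`);
4. the degenerate level `N = 0` (`Γ₀(0)` = upper triangular matrices) is settled directly: `φ(T^b) = φ(T^{9b}) = 9φ(T^b) = 0`.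
Plumbing: `g0Of_entries`, `apply_eq_of_restrictsFrom` (the entrywise `RestrictsFrom` is pointwise restriction along
`Gamma0.degeneracyConj M N 1`), `isDiamondChar_of_restrictsFrom`.
Nothing else is proved: the four structural rows stay hypotheses (obligation nodes of the tree), so E-es-94♯ itself is
NOT proved here; BSD is not proved by this; Manin's conjecture is not proved by this; C3 stays OPEN.

References: cell memo HOME/MEMO-es.md §37.8 (vi); H. Darmon, F. Diamond, R. Taylor, *Fermat's Last Theorem* (1995),
Lemma 4.28 (degeneracy maps on `Γ₀`; tree `Gamma0.degeneracyConj`) [cite: DarmonDiamondTaylor1995, Lemma 4.28 (p. 135)].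
-/

set_option autoImplicit false
set_option linter.dupNamespace false

open scoped MatrixGroups

open CongruenceSubgroup Matrix.SpecialLinearGroup
  Literature.NumberTheory.EllipticCurves.ModularForms
  Summit.BirchSwinnertonDyer.Rank1Residual.ManinAdditive.NineShiftEqualiser

namespace Summit.BirchSwinnertonDyer.BirchSwinnertonDyer.Theorems.ManinLocalTwoThree

/-! ### §1. Plumbing: entries, `g0Of`, restriction -/

section Plumbing

variable {M : ℕ}

/-- The determinant identity of `γ ∈ Γ₀(M)` on its entries. [folklore] -/
theorem gamma0_det_entries (γ : Gamma0 M) :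
    ((γ : SL(2, ℤ)) 0 0 : ℤ) * (γ : SL(2, ℤ)) 1 1 - ((γ : SL(2, ℤ)) 0 1 : ℤ) * (γ : SL(2, ℤ)) 1 0 = 1 := by
  have := Matrix.det_fin_two ((γ : SL(2, ℤ)) : Matrix (Fin 2) (Fin 2) ℤ)
  rw [(γ : SL(2, ℤ)).2] at this
  exact this.symm

/-- **Every `γ ∈ Γ₀(M)` is `g0Of` of its entries** (for any admissible proof arguments). [folklore] -/
theorem g0Of_entries (γ : Gamma0 M)
    (h : ((γ : SL(2, ℤ)) 0 0 : ℤ) * (γ : SL(2, ℤ)) 1 1 - ((γ : SL(2, ℤ)) 0 1 : ℤ) * (γ : SL(2, ℤ)) 1 0 = 1)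
    (hc : (M : ℤ) ∣ (γ : SL(2, ℤ)) 1 0) :
    g0Of ((γ : SL(2, ℤ)) 0 0) ((γ : SL(2, ℤ)) 0 1) ((γ : SL(2, ℤ)) 1 0) ((γ : SL(2, ℤ)) 1 1) h hc = γ := by
  apply Subtype.ext
  ext i j
  fin_cases i <;> fin_cases j <;> rfl

/-- `g0Of` at two levels has the same underlying matrix. [folklore] -/
theorem coe_g0Of_eq {M N : ℕ} (a b c d : ℤ) (h : a * d - b * c = 1) (hcN : (N : ℤ) ∣ c) (hcM : (M : ℤ) ∣ c) :
    ((g0Of a b c d h hcN : Gamma0 N) : SL(2, ℤ)) = ((g0Of a b c d h hcM : Gamma0 M) : SL(2, ℤ)) := rfl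

variable {N : ℕ}

/-- **`RestrictsFrom` is pointwise restriction**: if `φ` restricts from `w` (entrywise, as typed), then
`φ γ = w(γ)` for every `γ ∈ Γ₀(N) ≤ Γ₀(M)`. [folklore] -/
theorem apply_eq_of_restrictsFrom (hMN : M * 1 ∣ N) {φ : Gamma0 N → ZMod 3} {w : Gamma0 M → ZMod 3}
    (h : RestrictsFrom φ w) (γ : Gamma0 N) : φ γ = w (Gamma0.degeneracyConj M N 1 hMN γ) := by
  have hcN : (N : ℤ) ∣ (γ : SL(2, ℤ)) 1 0 := (ZMod.intCast_zmod_eq_zero_iff_dvd _ N).mp (Gamma0_mem.mp γ.2)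
  have hcM : (M : ℤ) ∣ (γ : SL(2, ℤ)) 1 0 := (Int.natCast_dvd_natCast.mpr (by simpa using hMN)).trans hcN
  have key := h ((γ : SL(2, ℤ)) 0 0) ((γ : SL(2, ℤ)) 0 1) ((γ : SL(2, ℤ)) 1 0) ((γ : SL(2, ℤ)) 1 1)
    (gamma0_det_entries γ) hcN hcM
  rw [g0Of_entries γ] at key
  rw [key]
  congr 1
  apply Subtype.ext
  rw [Gamma0.coe_degeneracyConj_one hMN γ, ← coe_g0Of_eq _ _ _ _ (gamma0_det_entries γ) hcN hcM,
    g0Of_entries γ]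

/-- Reduction of a congruence `mod N` to `mod M` for `M ∣ N`. [folklore] -/
theorem intCast_zmod_eq_of_dvd (hMN : M ∣ N) {x y : ℤ} (h : (x : ZMod N) = (y : ZMod N)) :
    (x : ZMod M) = (y : ZMod M) := by
  have := congrArg (ZMod.castHom hMN (ZMod M)) h
  simpa using this

/-- **Restriction of a diamond class is a diamond class** (`Γ₁(N) ≤ Γ₁(M)` for `M ∣ N`). [folklore] -/
theorem isDiamondChar_of_restrictsFrom (hMN : M ∣ N) {φ : Gamma0 N → ZMod 3} {w : Gamma0 M → ZMod 3}
    (hres : RestrictsFrom φ w) (hw : IsDiamondChar w) : IsDiamondChar φ := by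
  intro γ hγ
  have hMN' : M * 1 ∣ N := by simpa using hMN
  rw [apply_eq_of_restrictsFrom hMN' hres]
  obtain ⟨h00, h11, h10⟩ := (Gamma1_mem N γ).mp hγ
  have hγM : γ ∈ Gamma1 M := by
    rw [Gamma1_mem]
    refine ⟨?_, ?_, ?_⟩
    · have := intCast_zmod_eq_of_dvd hMN (x := (γ 0 0 : ℤ)) (y := 1) (by push_cast; exact h00)
      push_cast at this; exact this
    · have := intCast_zmod_eq_of_dvd hMN (x := (γ 1 1 : ℤ)) (y := 1) (by push_cast; exact h11)
      push_cast at this; exact this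
    · have := intCast_zmod_eq_of_dvd hMN (x := (γ 1 0 : ℤ)) (y := 0) (by push_cast; exact h10)
      push_cast at this; exact this
  have e : Gamma0.degeneracyConj M N 1 hMN' ⟨γ, Gamma1_in_Gamma0 N hγ⟩ = ⟨γ, Gamma1_in_Gamma0 M hγM⟩ :=
    Subtype.ext (Gamma0.coe_degeneracyConj_one hMN' _)
  rw [e]
  exact hw γ hγM

/-- Restriction of the zero character is zero. [folklore] -/
theorem eq_zero_of_restrictsFrom (hMN : M ∣ N) {φ : Gamma0 N → ZMod 3} {w : Gamma0 M → ZMod 3}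
    (hres : RestrictsFrom φ w) (hw : ∀ δ : Gamma0 M, w δ = 0) (γ : Gamma0 N) : φ γ = 0 := by
  have hMN' : M * 1 ∣ N := by simpa using hMN
  rw [apply_eq_of_restrictsFrom hMN' hres, hw]

end Plumbing

/-! ### §2. The 3-shift defect of a nine-shift-invariant character is anti-invariant -/

section Defect

variable {N : ℕ}

/-- `N·1 ∣ 3N`. [folklore] -/
theorem dvd_three_mul_one (N : ℕ) : N * 1 ∣ 3 * N := ⟨3, by ring⟩
/-- `N·3 ∣ 3N`. [folklore] -/
theorem dvd_three_mul_three (N : ℕ) : N * 3 ∣ 3 * N := ⟨1, by ring⟩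

/-- The inclusion `Γ₀(3N) → Γ₀(N)` on an explicit matrix. [cite: DarmonDiamondTaylor1995, Lemma 4.28 (p. 135)] -/
theorem degeneracyConj_one_g0Of (a b c d : ℤ) (h : a * d - b * c = 1) (hc : ((3 * N : ℕ) : ℤ) ∣ c)
    (hcN : (N : ℤ) ∣ c) :
    Gamma0.degeneracyConj N (3 * N) 1 (dvd_three_mul_one N) (g0Of a b c d h hc) = g0Of a b c d h hcN :=
  Subtype.ext (Gamma0.coe_degeneracyConj_one _ _)

/-- The 3-shift `Γ₀(3N) → Γ₀(N)`, `γ ↦ diag(3,1) γ diag(3,1)⁻¹`, on an explicit matrix `(a b; 3c₀ d) ↦ (a 3b; c₀ d)`.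
[cite: DarmonDiamondTaylor1995, Lemma 4.28 (p. 135)] -/
theorem degeneracyConj_three_g0Of (a b c₀ d : ℤ) (h : a * d - b * (3 * c₀) = 1)
    (hc : ((3 * N : ℕ) : ℤ) ∣ 3 * c₀) (hc₀ : (N : ℤ) ∣ c₀) :
    Gamma0.degeneracyConj N (3 * N) 3 (dvd_three_mul_three N) (g0Of a b (3 * c₀) d h hc) =
      g0Of a (3 * b) c₀ d (by linear_combination h) hc₀ := by
  apply Subtype.ext
  ext i j
  have e10 : (3 : ℤ) * c₀ / 3 = c₀ := Int.mul_ediv_cancel_left c₀ (by norm_num)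
  fin_cases i <;> fin_cases j <;>
    simp [Gamma0.degeneracyConjElt, g0Of, slOf, e10]

/-- **The 3-shift defect is additive**: `ψ(γ) := φ(γ) − φ(diag(3,1) γ diag(3,1)⁻¹)` on `Γ₀(3N)`, for additive `φ` on
`Γ₀(N)` (both arguments are values of group homomorphisms `Gamma0.degeneracyConj`). [folklore] -/
theorem isAddChar_shiftDefect {φ : Gamma0 N → ZMod 3} (hφ : IsAddChar φ) :
    IsAddChar (fun γ : Gamma0 (3 * N) =>
      φ (Gamma0.degeneracyConj N (3 * N) 1 (dvd_three_mul_one N) γ) -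
        φ (Gamma0.degeneracyConj N (3 * N) 3 (dvd_three_mul_three N) γ)) := by
  intro γ δ
  simp only [map_mul]
  rw [hφ, hφ]
  ring

/-- **The 3-shift defect of a NINE-shift-invariant additive character is 3-shift ANTI-invariant**:
`ψ(a 3b; c d) + ψ(a b; 3c d) = φ(a b; 3c d) − φ(a 9b; c/3 d) = 0` by nine-shift invariance at `(a, b, c/3, d)`.
[folklore] -/
theorem isThreeShiftAntiInvariant_shiftDefect {φ : Gamma0 N → ZMod 3}
    (h9 : IsNineShiftInvariant φ) :
    IsThreeShiftAntiInvariant (fun γ : Gamma0 (3 * N) =>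
      φ (Gamma0.degeneracyConj N (3 * N) 1 (dvd_three_mul_one N) γ) -
        φ (Gamma0.degeneracyConj N (3 * N) 3 (dvd_three_mul_three N) γ)) := by
  intro a b c d hdet hc
  -- `c = 3 N k`
  obtain ⟨k, hk⟩ := hc
  have hc3 : c = 3 * ((N : ℤ) * k) := by rw [hk]; push_cast; ring
  subst hc3
  have hNk : (N : ℤ) ∣ (N : ℤ) * k := Dvd.intro k rfl
  have hN3k : (N : ℤ) ∣ 3 * ((N : ℤ) * k) := Dvd.dvd.mul_left hNk 3
  have h3N3k : ((3 * N : ℕ) : ℤ) ∣ 3 * ((N : ℤ) * k) := ⟨k, by push_cast; ring⟩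
  have h3N9k : ((3 * N : ℕ) : ℤ) ∣ 3 * (3 * ((N : ℤ) * k)) := ⟨3 * k, by push_cast; ring⟩
  simp only
  -- the four matrices at level `N`
  rw [degeneracyConj_one_g0Of a (3 * b) (3 * ((N : ℤ) * k)) d _ _ hN3k,
    degeneracyConj_three_g0Of a (3 * b) ((N : ℤ) * k) d (by linear_combination hdet) _ hNk,
    degeneracyConj_one_g0Of a b (3 * (3 * ((N : ℤ) * k))) d hdet _ (Dvd.dvd.mul_left hN3k 3),
    degeneracyConj_three_g0Of a b (3 * ((N : ℤ) * k)) d hdet _ hN3k]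
  -- nine-shift invariance at `(a, b, N k, d)`
  have key := h9 a b ((N : ℤ) * k) d (by linear_combination hdet) hNk
  have e₁ : g0Of (M := N) a (9 * b) ((N : ℤ) * k) d (by linear_combination hdet) hNk =
      g0Of a (3 * (3 * b)) ((N : ℤ) * k) d (by linear_combination hdet) hNk :=
    g0Of_congr rfl (by ring) rfl rfl _ _ _ _
  have e₂ : g0Of (M := N) a b (9 * ((N : ℤ) * k)) d (by linear_combination hdet) (Dvd.dvd.mul_left hNk 9) =
      g0Of a b (3 * (3 * ((N : ℤ) * k))) d hdet (Dvd.dvd.mul_left hN3k 3) :=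
    g0Of_congr rfl rfl (by ring) rfl _ _ _ _
  rw [e₁, e₂] at key
  rw [key]
  ring

/-- **If the 3-shift defect vanishes, `φ` is 3-shift invariant.** [folklore] -/
theorem isThreeShiftInvariant_of_shiftDefect_eq_zero {φ : Gamma0 N → ZMod 3}
    (h0 : ∀ γ : Gamma0 (3 * N),
      φ (Gamma0.degeneracyConj N (3 * N) 1 (dvd_three_mul_one N) γ) -
        φ (Gamma0.degeneracyConj N (3 * N) 3 (dvd_three_mul_three N) γ) = 0) :
    IsThreeShiftInvariant φ := by
  intro a b c d hdet hc
  have h3Nc : ((3 * N : ℕ) : ℤ) ∣ 3 * c := by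
    obtain ⟨k, hk⟩ := hc
    exact ⟨k, by rw [hk]; push_cast; ring⟩
  have key := h0 (g0Of a b (3 * c) d hdet h3Nc)
  rw [degeneracyConj_one_g0Of a b (3 * c) d hdet h3Nc (Dvd.dvd.mul_left hc 3),
    degeneracyConj_three_g0Of a b c d hdet h3Nc hc, sub_eq_zero] at key
  exact key.symm

end Defect

/-! ### §3. Descending the 3-adic tower -/

section Tower

/-- **Anti-invariant tower**: given III′ (`ThreeShiftAntiInvariantDescent`) and E-es-100b, every additive
3-shift-anti-invariant character of `Γ₀(3^j · 27N₀)` (`3 ∤ N₀`, `N₀ > 0`) vanishes. [folklore] -/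
theorem eq_zero_of_antiInvariant_tower (hAD : ThreeShiftAntiInvariantDescent) (hB : AntiInvariantBaseTwentySeven)
    {N₀ : ℕ} (hN₀ : 0 < N₀) (h3 : ¬ 3 ∣ N₀) :
    ∀ (j L : ℕ), L = 3 ^ j * (27 * N₀) → ∀ ψ : Gamma0 L → ZMod 3, IsAddChar ψ → IsThreeShiftAntiInvariant ψ →
      ∀ γ : Gamma0 L, ψ γ = 0 := by
  intro j
  induction j with
  | zero =>
      intro L hL ψ hadd hanti
      have hL' : L = 27 * N₀ := by rw [hL]; ring
      subst hL'
      exact hB N₀ hN₀ h3 ψ hadd hanti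
  | succ j ih =>
      intro L hL ψ hadd hanti
      have hL' : L = 3 * (3 ^ j * (27 * N₀)) := by rw [hL]; ring
      subst hL'
      have h27 : 27 ∣ 3 ^ j * (27 * N₀) := ⟨3 ^ j * N₀, by ring⟩
      obtain ⟨w, hwadd, hwanti, hres⟩ := hAD (3 ^ j * (27 * N₀)) h27 ψ hadd hanti
      have hw0 := ih (3 ^ j * (27 * N₀)) rfl w hwadd hwanti
      exact eq_zero_of_restrictsFrom ⟨3, by ring⟩ hres hw0

/-- **Invariant tower**: given III (`ThreeShiftTowerDescent`) and E-es-100a, every additive 3-shift-invariant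
character of `Γ₀(3^j · 9N₀)` (`3 ∤ N₀`, `N₀ > 0`) is a diamond class. [folklore] -/
theorem isDiamondChar_of_tower (hTD : ThreeShiftTowerDescent) (hB : ThreeShiftBaseNine)
    {N₀ : ℕ} (hN₀ : 0 < N₀) (h3 : ¬ 3 ∣ N₀) :
    ∀ (j L : ℕ), L = 3 ^ j * (9 * N₀) → ∀ φ : Gamma0 L → ZMod 3, IsAddChar φ → IsThreeShiftInvariant φ →
      IsDiamondChar φ := by
  intro j
  induction j with
  | zero =>
      intro L hL φ hadd hinv
      have hL' : L = 9 * N₀ := by rw [hL]; ring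
      subst hL'
      exact hB N₀ hN₀ h3 φ hadd hinv
  | succ j ih =>
      intro L hL φ hadd hinv
      have hL' : L = 3 * (3 ^ j * (9 * N₀)) := by rw [hL]; ring
      subst hL'
      have h9 : 9 ∣ 3 ^ j * (9 * N₀) := ⟨3 ^ j * N₀, by ring⟩
      obtain ⟨w, hwadd, hwinv, hres⟩ := hTD (3 ^ j * (9 * N₀)) h9 φ hadd hinv
      have hwD := ih (3 ^ j * (9 * N₀)) rfl w hwadd hwinv
      exact isDiamondChar_of_restrictsFrom ⟨3, by ring⟩ hres hwD

end Tower

/-! ### §4. The degenerate level `N = 0` -/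

section LevelZero

/-- An additive character kills the identity. [folklore] -/
theorem isAddChar_map_one {N : ℕ} {φ : Gamma0 N → ZMod 3} (hφ : IsAddChar φ) : φ 1 = 0 := by
  have h := hφ 1 1
  rw [mul_one] at h
  have : φ 1 + φ 1 - φ 1 = φ 1 - φ 1 := by rw [← h]
  simpa using this

/-- An additive character on powers: `φ(γ^n) = n • φ(γ)`. [folklore] -/
theorem isAddChar_map_pow {N : ℕ} {φ : Gamma0 N → ZMod 3} (hφ : IsAddChar φ) (γ : Gamma0 N) (n : ℕ) :
    φ (γ ^ n) = n • φ γ := by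
  induction n with
  | zero => rw [pow_zero, isAddChar_map_one hφ, zero_smul]
  | succ n ih => rw [pow_succ, hφ, ih, succ_nsmul]

/-- Powers of the unipotent `(1 b; 0 1) ∈ Γ₀(0)`: `(1 b; 0 1)^n = (1 nb; 0 1)`. [folklore] -/
theorem g0Of_unipotent_pow (b : ℤ) (n : ℕ) :
    (g0Of (M := 0) 1 b 0 1 (by ring) (dvd_refl _)) ^ n = g0Of 1 ((n : ℤ) * b) 0 1 (by ring) (dvd_refl _) := by
  induction n with
  | zero =>
      rw [pow_zero]
      apply Subtype.ext
      ext i j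
      fin_cases i <;> fin_cases j <;> simp [g0Of, slOf]
  | succ n ih =>
      rw [pow_succ, ih]
      apply Subtype.ext
      ext i j
      fin_cases i <;> fin_cases j
      · simp [g0Of, slOf, Matrix.mul_apply, Fin.sum_univ_two]
      · simp [g0Of, slOf, Matrix.mul_apply, Fin.sum_univ_two]; ring
      · simp [g0Of, slOf, Matrix.mul_apply, Fin.sum_univ_two]
      · simp [g0Of, slOf, Matrix.mul_apply, Fin.sum_univ_two]

/-- **The law at the degenerate level `N = 0`** (`Γ₀(0)` = upper triangular matrices): an additive nine-shift-invariant
`φ : Γ₀(0) → 𝔽₃` is a diamond class, since every `γ ∈ Γ₁(0)` is `(1 b; 0 1)` and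
`φ(1 b; 0 1) = φ(1 9b; 0 1) = 9·φ(1 b; 0 1) = 0`. [folklore] -/
theorem nineShiftInvariantIsDiamond_zero (φ : Gamma0 0 → ZMod 3) (hadd : IsAddChar φ)
    (h9 : IsNineShiftInvariant φ) : IsDiamondChar φ := by
  intro γ hγ
  obtain ⟨h00, h11, h10⟩ := (Gamma1_mem 0 γ).mp hγ
  have e00 : (γ 0 0 : ℤ) = 1 := by
    have := (ZMod.intCast_eq_intCast_iff' (γ 0 0 : ℤ) 1 0).mp (by exact_mod_cast h00)
    simpa using this
  have e11 : (γ 1 1 : ℤ) = 1 := by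
    have := (ZMod.intCast_eq_intCast_iff' (γ 1 1 : ℤ) 1 0).mp (by exact_mod_cast h11)
    simpa using this
  have e10 : (γ 1 0 : ℤ) = 0 := by
    have := (ZMod.intCast_zmod_eq_zero_iff_dvd (γ 1 0 : ℤ) 0).mp (by exact_mod_cast h10)
    simpa using this
  set δ : Gamma0 0 := ⟨γ, Gamma1_in_Gamma0 0 hγ⟩ with hδ
  have hdet := gamma0_det_entries δ
  have hdvd : ((0 : ℕ) : ℤ) ∣ (δ : SL(2, ℤ)) 1 0 := (ZMod.intCast_zmod_eq_zero_iff_dvd _ 0).mp (Gamma0_mem.mp δ.2)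
  have eδ : δ = g0Of (M := 0) 1 ((γ 0 1 : ℤ)) 0 1 (by ring) (dvd_refl _) := by
    rw [← g0Of_entries δ hdet hdvd]
    exact g0Of_congr e00 rfl e10 e11 _ _ _ _
  rw [eδ]
  -- nine-shift invariance at `(1, b, 0, 1)` and additivity on the ninth power
  have key := h9 1 ((γ 0 1 : ℤ)) 0 1 (by ring) (dvd_refl _)
  have e₁ : g0Of (M := 0) 1 ((γ 0 1 : ℤ)) (9 * 0) 1 (by ring) (Dvd.dvd.mul_left (dvd_refl _) 9) =
      g0Of 1 ((γ 0 1 : ℤ)) 0 1 (by ring) (dvd_refl _) := g0Of_congr rfl rfl (by ring) rfl _ _ _ _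
  have e₂ : g0Of (M := 0) 1 (9 * (γ 0 1 : ℤ)) 0 1 (by ring) (dvd_refl _) =
      (g0Of (M := 0) 1 ((γ 0 1 : ℤ)) 0 1 (by ring) (dvd_refl _)) ^ 9 := by
    rw [g0Of_unipotent_pow]; rfl
  rw [e₁, e₂, isAddChar_map_pow hadd] at key
  -- `9 • x = 0` in `ZMod 3`, so `x = 9 • x = 0`
  have h9x : (9 : ℕ) • φ (g0Of (M := 0) 1 ((γ 0 1 : ℤ)) 0 1 (by ring) (dvd_refl _)) = 0 := by
    rw [show (9 : ℕ) = 3 * 3 from rfl, mul_nsmul]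
    generalize φ (g0Of (M := 0) 1 ((γ 0 1 : ℤ)) 0 1 (by ring) (dvd_refl _)) = x
    have : (3 : ℕ) • x = 0 := by
      rw [nsmul_eq_mul]; push_cast
      have : (3 : ZMod 3) = 0 := by decide
      rw [this, zero_mul]
    rw [this, nsmul_zero]
  rw [← key, h9x]

end LevelZero

/-! ### §5. E-es-101 `TowerReduction` holds -/
/-- **E-es-101 `TowerReduction` HOLDS**: the four structural rows (THEOREM III `ThreeShiftTowerDescent`, THEOREM III′
`ThreeShiftAntiInvariantDescent`, E-es-100a `ThreeShiftBaseNine`, E-es-100b `AntiInvariantBaseTwentySeven`) imply the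
sharp nine-shift equaliser law E-es-94♯ `NineShiftInvariantIsDiamond` at every level `9 ∣ N`.  Pure glue (MEMO-es §37.8
(vi)): `N = 3^k N₀`; the 3-shift defect of `φ` on `Γ₀(3N) = Γ₀(3^(k−2)·27N₀)` is anti-invariant, descends by III′ and dies
at `27N₀`; so `φ` is 3-shift invariant on `Γ₀(N) = Γ₀(3^(k−2)·9N₀)`, descends by III and is diamond at `9N₀`; `N = 0` apart.
[cite: DarmonDiamondTaylor1995, Lemma 4.28 (p. 135)] -/
theorem towerReduction_holds : TowerReduction := by
  intro hTD hAD hB9 hB27 N h9N φ hadd h9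
  by_cases hN0 : N = 0
  · subst hN0
    exact nineShiftInvariantIsDiamond_zero φ hadd h9
  -- `N = 3^k · N₀`, `3 ∤ N₀`, `k ≥ 2`
  obtain ⟨k, N₀, h3, hN⟩ := Nat.exists_eq_pow_mul_and_not_dvd hN0 3 (by norm_num)
  have hN₀ : 0 < N₀ := by
    rcases Nat.eq_zero_or_pos N₀ with h | h
    · exact absurd (by rw [hN, h, mul_zero]) hN0
    · exact h
  have hk : 2 ≤ k := by
    by_contra hk
    have hk' : k = 0 ∨ k = 1 := by omega
    rcases hk' with rfl | rfl
    · apply h3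
      have : 9 ∣ N₀ := by simpa [hN] using h9N
      exact (dvd_trans ⟨3, by norm_num⟩ this)
    · apply h3
      have h9' : 9 ∣ 3 * N₀ := by simpa [hN] using h9N
      obtain ⟨m, hm⟩ := h9'
      exact ⟨m, by omega⟩
  obtain ⟨j, rfl⟩ : ∃ j, k = j + 2 := ⟨k - 2, by omega⟩
  -- Step 1–2: the 3-shift defect vanishes, so `φ` is 3-shift invariant
  have hL3 : 3 * N = 3 ^ j * (27 * N₀) := by rw [hN]; ring
  have hψ0 := eq_zero_of_antiInvariant_tower hAD hB27 hN₀ h3 j (3 * N) hL3 _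
    (isAddChar_shiftDefect hadd) (isThreeShiftAntiInvariant_shiftDefect h9)
  have h3inv : IsThreeShiftInvariant φ := isThreeShiftInvariant_of_shiftDefect_eq_zero hψ0
  -- Step 3: descend by III and conclude at `9 N₀`
  have hL9 : N = 3 ^ j * (9 * N₀) := by rw [hN]; ring
  exact isDiamondChar_of_tower hTD hB9 hN₀ h3 j N hL9 φ hadd h3inv

end Summit.BirchSwinnertonDyer.BirchSwinnertonDyer.Theorems.ManinLocalTwoThree
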